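import Summits.KontsevichZagierPeriods.KontsevichZagierPeriods.Theorems.GaussManinCertificatesKZStokesBox

/-!
# `CompleteModGammaSector` (stmt-KontsevichZagierPeriods-14233), line
# cusp-transport-to-the-beta-world: engine stub `stub_kzStokesBox`

The box-Stokes move of the Kontsevich–Zagier calculus on an OPEN box `∏ᵢ (aᵢ, bᵢ) ⊆ ℝⁿ⁺¹` with
real corners `a < b` [Kontsevich–Zagier 2001, §1.2, rules 1) and 3)]: for `r : KZ.IntegralRep (n + 1)`
with domain the open box and a primitive `H`, `ℚ`-semialgebraic on the closed box, fibrewise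
continuous on `[a_last, b_last]`, vanishing at both ends and with fibrewise derivative
`r.integrand` on `(a_last, b_last)`, the class `[r]` lies in `KZ.relations` (the corners are
algebraic automatically, the box being `ℚ`-semialgebraic).

This is, token for token, the support item `KZStokesBox` (stmt-KontsevichZagierPeriods-3015) of the
route `GaussManinCertificates`, proved there by
`Summit.KontsevichZagierPeriods.GaussManinCertificates.KZStokesBox_proof`
(`Theorems/GaussManinCertificatesKZStokesBox.lean`). It was registered as a stub of the cusp line's
engine (namespace `CompleteModGammaSectorEngine`, next to `stub_stokesBoxAlg` / `stub_stokesBoxBand`)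
before that proof landed; this file re-exports the proof under the registered name to close the
registration. No named fact is assumed; no new definition.
-/

noncomputable section

-- `Summit.KontsevichZagierPeriods.KontsevichZagierPeriods.…` is the tree's mandated layout (single-conjunct summit).
set_option linter.dupNamespace false

namespace Summit.KontsevichZagierPeriods.KontsevichZagierPeriods.CompleteModGammaSectorEngine

open Literature.NumberTheory.Transcendental Literature.NumberTheory.Transcendental.KZ MeasureTheory Set

/-- **`stub_kzStokesBox`** (engine of the line cusp-transport-to-the-beta-world of
`CompleteModGammaSector`): Newton–Leibniz / box-Stokes on an open box with real corners. For
`r : KZ.IntegralRep (n + 1)` whose domain is the open box `∏ᵢ (aᵢ, bᵢ)` (`a < b`) and `H`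
`ℚ`-semialgebraic on the closed box which, on every vertical fibre over the open base box, is
continuous on `[a_last, b_last]`, vanishes at both ends and has derivative `r.integrand` on
`(a_last, b_last)`, one has `KZ.of r ∈ KZ.relations`. This is verbatim the `GaussManinCertificates`
support item `KZStokesBox` (stmt-KontsevichZagierPeriods-3015), re-exported from
`GaussManinCertificates.KZStokesBox_proof` (one Newton–Leibniz move on the band over the open base
box, two null faces by domain additivity, integrand additivity on the open box).
[cite: KontsevichZagier2001, §1.2 rules 1) and 3)] -/
theorem stub_kzStokesBox : ∀ (n : ℕ) (a b : Fin (n + 1) → ℝ) (r : IntegralRep (n + 1)) (H : (Fin (n + 1) → ℝ) → ℝ), (∀ i, a i < b i) → r.domain = {z | ∀ i, z i ∈ Set.Ioo (a i) (b i)} → IsSemialgebraicFunOn ℚ {z | ∀ i, z i ∈ Set.Icc (a i) (b i)} H → (∀ x : Fin n → ℝ, (∀ i, x i ∈ Set.Ioo (a (Fin.castSucc i)) (b (Fin.castSucc i))) → ContinuousOn (fun s : ℝ => H (Fin.snoc x s)) (Set.Icc (a (Fin.last n)) (b (Fin.last n))) ∧ H (Fin.snoc x (a (Fin.last n))) = 0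 ∧ H (Fin.snoc x (b (Fin.last n))) = 0 ∧ ∀ t ∈ Set.Ioo (a (Fin.last n)) (b (Fin.last n)), HasDerivAt (fun s : ℝ => H (Fin.snoc x s)) (r.integrand (Fin.snoc x t)) t) → of r ∈ relations :=
  Summit.KontsevichZagierPeriods.GaussManinCertificates.KZStokesBox_proof

end Summit.KontsevichZagierPeriods.KontsevichZagierPeriods.CompleteModGammaSectorEngine
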